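import Mathlib
import Summits.Ventures.HodgeRepro.Tier4.Common.SettingOfData
import Summits.Ventures.HodgeRepro.Tier4.Line1.PlaneDefs
import Summits.Ventures.HodgeRepro.Tier4.Line1.ThreeLines
import Summits.Ventures.HodgeRepro.Tier4.Line1.LinRegular
import Summits.Ventures.HodgeRepro.Tier4.Line1.RationalConj
import Summits.Ventures.HodgeRepro.Tier4.Line1.QuotientCompact
import Summits.Ventures.HodgeRepro.Tier4.Line1.IsolatingNbhd
import Summits.Ventures.HodgeRepro.Tier4.Line1.OrbitalPositive
import Summits.Ventures.HodgeRepro.Tier4.Line1.RationalPoints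
import Summits.Ventures.HodgeRepro.Tier4.Line1.LocallyCompactGA
import Summits.Ventures.HodgeRepro.Tier4.Line1.CocompactReduction
import Summits.Ventures.HodgeRepro.Tier4.Line4.GeometricBridge

/-!
# Tier4/Line4/DistributionNonzero — the WEAK form of W5, assembled BY NAME from LINE L1's landed theorems: on a
genuine-row plane that is definite at SOME real place, the two-torus distribution `f ↦ R.Jc f` is NOT identically zero
on the test functions (census row V5.6, corrected: PROVED as a theorem of the tree, explicitly NOT the wall)

Blind re-derivation cell `pub-hodge-repro`, Tier 4 «prove the step» (README §9–§10), seat t4-L4-p2 (gen 2; lead g385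
cut S13064 (5): W4 / W5).  Tree path `lean/Summits/Ventures/HodgeRepro/Tier4/Line4/DistributionNonzero.lean`.

WHAT IS PROVED.  `exists_test_Jc_ne_zero`: for `W : PlaneData k` with `hW : IsDefinite W` (definite at some real place —
for LINE L4's seesaw plane, which has signature `(1,1)` at `w₀`, this is definiteness at ANOTHER real place of `k`,
a property of the face's signs, DISPLAYED) and `hg : IsGenuineRow W`, an `RTFData W` whose fundamental domains have
compact closures (`compT`, `compT'` — Fujisaki, DISPLAYED), continuous unitary characters `χ`, `χ′` (DISPLAYED):
`∃ f, IsTestFn W f ∧ R.Jc f ≠ 0`.  CHAIN (every link a landed module, consumed by name): the cocompactness of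
`G(k)\G(𝔸)` for such a plane = L1-p5's `quotient_compact_genuine` (QuotientCompact p676024: `DG` with compact closure)
⇒ typer-2's `Setting.ofAdelicData` (SettingOfData p675640) is a sorry-free `RTF.Setting`; a LINEARLY regular rational
element exists = L1-p3's `exists_regular_rational` (LinRegular p669614); linear regularity gives Jacquet regularity
(`isRegularRational_of_isLinRegular`, plan-1's skeleton glue v0.17 re-proved here, 24 lines, with L1-p3's
`mem_center_of_mat_eq_scalar`); adelic conjugacy of rational points is rational conjugacy = L1-p2's
`exists_rational_conj` (RationalConj p670211) ⇒ the Hasse-type hypothesis of L1-p1's `exists_isolating_nbhd_of_hasse`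
(IsolatingNbhd p665251): an open `U ∋ γ₀` meeting, from the closures of the domains, no rational double coset but
`[γ₀]`; a non-negative bump at `γ₀` supported in `U` has `Re O_{[γ₀]} > 0` = L1-p2's `exists_test_orbital_re_pos`
(OrbitalPositive); its geometric support is exactly `{[γ₀]}`, so by this line's `Jc_eq_orbital_of_isolated`
(GeometricBridge p676398 = L1-p2's `rtf_geometric` by name) `Jc f = O_{[γ₀]}(f) ≠ 0`.

WHAT THIS IS NOT.  It is NOT W5 as the wall needs it: W4's family must be ADMISSIBLE (`IsAdmissible`: the weight-3
K-types, LOWEST at `w₀`), which forces the archimedean component of the test function into the discrete series (a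
matrix coefficient, not a non-negative bump); for THAT `f` the non-vanishing of the identity orbital integral is an
unprinted archimedean computation (census v0.4 V5.5).  So this theorem locates the wall exactly: the two-torus
distribution is non-zero, and everything that remains is the K-type constraint on the spectral side (W4) together
with the archimedean orbital integral for an admissible test function (W5 proper).  Nothing on the wall is closed.
HC_CM is NOT proved by anyone in this repository.
-/

set_option autoImplicit false

noncomputable section

namespace Summit.Ventures.HodgeRepro.Tier4.Line4

open Summit.Ventures.HodgeRepro.Tier4.Common Summit.Ventures.HodgeRepro.Tier4.Line1 MeasureTheory NumberField
  Topology

section Regular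

variable {k : Type} [Field k] [NumberField k] (W : PlaneData k)

/-- **Linear regularity gives Jacquet regularity** (plan-1's skeleton glue v0.17, re-proved): restrict `IsLinRegular` to
unitaries `t ∈ T`, `t′ ∈ T′` with `t⁻¹ γ₀ t′ = γ₀` — then `t = t′` is an `E′_𝔸`-scalar, central by L1-p3's
`mem_center_of_mat_eq_scalar`. -/
theorem isRegularRational_of_isLinRegular (γ₀ : rationalPoints W) (h : IsLinRegular W γ₀) :
    IsRegularRational W γ₀ := by
  intro t ht t' ht' hγ
  have hmat : GA.mat W t * GA.mat W (γ₀ : GA W) = GA.mat W (γ₀ : GA W) * GA.mat W t' := by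
    have h1 : (γ₀ : GA W) * t' = t * γ₀ := by
      calc (γ₀ : GA W) * t' = t * (t⁻¹ * γ₀ * t') := by group
        _ = t * γ₀ := by rw [hγ]
    have := congrArg (GA.mat W) h1.symm
    simpa [GA.mat_mul] using this
  have htΩ : GA.mat W t * adMat k W.Ω = adMat k W.Ω * GA.mat W t := ((mem_unitaryGroup W _).mp t.2).1
  have ht'Ω : GA.mat W t' * adMat k W.Ω = adMat k W.Ω * GA.mat W t' := ((mem_unitaryGroup W _).mp t'.2).1
  have htP : ∀ i, GA.mat W t * adMat k (W.P i) = adMat k (W.P i) * GA.mat W t := by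
    intro i; fin_cases i
    · exact ht.1
    · exact ht.2
  have ht'Q : ∀ i, GA.mat W t' * adMat k (W.Q i) = adMat k (W.Q i) * GA.mat W t' := by
    intro i; fin_cases i
    · exact ht'.1
    · exact ht'.2
  obtain ⟨x, y, hx, hx'⟩ := h _ _ htΩ htP ht'Ω ht'Q hmat
  have htt' : t' = t := by
    apply Subtype.ext; apply Units.ext
    show GA.mat W t' = GA.mat W t
    rw [hx, hx']
  subst htt'
  exact ⟨⟨⟨ht, ht'⟩, mem_center_of_mat_eq_scalar W t' hx⟩, rfl⟩

end Regular

section Main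

variable {k : Type} [Field k] [NumberField k] (W : PlaneData k) [MeasurableSpace (GA W)] [BorelSpace (GA W)]
  (R : RTFData W) [R.μT.IsHaarMeasure] [R.μT'.IsHaarMeasure]

/-- **J2.b on the data setting** (plan-1's skeleton glue, re-proved on `Setting.ofAdelicData`): two rational points
of one adelic `T × T′`-orbit lie in one rational double coset (L1-p2's `exists_rational_conj`). -/
theorem orbitOf_eq_of_conj (μ : Measure (GA W)) [μ.IsHaarMeasure] (DG : Set (GA W))
    (fdG : IsFundamentalDomain (rationalPoints W) DG μ) (compG : IsCompact (closure DG))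
    (compT : IsCompact (closure R.DT)) (compT' : IsCompact (closure R.DT')) (hW : IsDefinite W) (hg : IsGenuineRow W)
    (γ γ₀ : rationalPoints W) (hreg : IsLinRegular W γ₀)
    (h : ∃ t ∈ torusT W, ∃ t' ∈ torusT' W, t⁻¹ * γ * t' = γ₀) :
    (Setting.ofAdelicData W R μ DG fdG compG compT compT').orbitOf γ =
      (Setting.ofAdelicData W R μ DG fdG compG compT compT').orbitOf γ₀ := by
  obtain ⟨δ, hδ, δ', hδ', hδk, hδ'k, hconj⟩ := exists_rational_conj W hW hg γ γ₀ hreg h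
  show DoubleCoset.mk _ _ γ = DoubleCoset.mk _ _ γ₀
  rw [DoubleCoset.eq]
  refine ⟨⟨δ⁻¹, (rationalPoints W).inv_mem hδk⟩, ?_, ⟨δ', hδ'k⟩, ?_, ?_⟩
  · show δ⁻¹ ∈ torusT W
    exact (torusT W).inv_mem hδ
  · show δ' ∈ torusT' W
    exact hδ'
  · apply Subtype.ext
    exact hconj.symm

/-- **An isolating neighbourhood of a regular rational element** (L1-p1's `exists_isolating_nbhd_of_hasse` with J2.b):
an open `U ∋ γ₀` such that every rational `γ` reaching `U` from `closure D_T × closure D_{T′}` lies in `[γ₀]`. -/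
theorem exists_isolating_nbhd (μ : Measure (GA W)) [μ.IsHaarMeasure] (DG : Set (GA W))
    (fdG : IsFundamentalDomain (rationalPoints W) DG μ) (compG : IsCompact (closure DG))
    (compT : IsCompact (closure R.DT)) (compT' : IsCompact (closure R.DT')) (hW : IsDefinite W) (hg : IsGenuineRow W)
    (γ₀ : rationalPoints W) (hreg : IsLinRegular W γ₀) :
    ∃ U : Set (GA W), IsOpen U ∧ (γ₀ : GA W) ∈ U ∧
      ∀ t ∈ closure R.DT, ∀ t' ∈ closure R.DT', ∀ γ : rationalPoints W, (t : GA W)⁻¹ * γ * t' ∈ U →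
        (Setting.ofAdelicData W R μ DG fdG compG compT compT').orbitOf γ =
          (Setting.ofAdelicData W R μ DG fdG compG compT compT').orbitOf γ₀ := by
  haveI : T2Space (GA W) := t2Space_GA W
  haveI : LocallyCompactSpace (GA W) := locallyCompact_GA W
  exact (Setting.ofAdelicData W R μ DG fdG compG compT compT').exists_isolating_nbhd_of_hasse γ₀
    (fun γ h => orbitOf_eq_of_conj W R μ DG fdG compG compT compT' hW hg γ γ₀ hreg h)

/-- **The double period of a test function isolated at a regular `γ₀` is its orbital term, and it is non-zero**: the
bump of L1-p2's `exists_test_orbital_re_pos` inside the isolating neighbourhood has geometric support `{[γ₀]}` and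
`Re O_{[γ₀]} > 0`. -/
theorem exists_test_Jc_ne_zero_of_data (μ : Measure (GA W)) [μ.IsHaarMeasure] (DG : Set (GA W))
    (fdG : IsFundamentalDomain (rationalPoints W) DG μ) (compG : IsCompact (closure DG))
    (compT : IsCompact (closure R.DT)) (compT' : IsCompact (closure R.DT')) (hW : IsDefinite W) (hg : IsGenuineRow W)
    (hc : Continuous R.chi) (hu : ∀ a, ‖R.chi a‖ = 1) (hc' : Continuous R.chi') (hu' : ∀ a, ‖R.chi' a‖ = 1)
    (γ₀ : rationalPoints W) (hreg : IsLinRegular W γ₀) :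
    ∃ f : GA W → ℂ, IsTestFn W f ∧ R.Jc f ≠ 0 := by
  set S := Setting.ofAdelicData W R μ DG fdG compG compT compT' with hS
  haveI : T2Space (GA W) := t2Space_GA W
  haveI : LocallyCompactSpace (GA W) := locallyCompact_GA W
  haveI : Countable S.Gk := rationalPoints_countable W
  obtain ⟨U, hU, hγU, hiso⟩ := exists_isolating_nbhd W R μ DG fdG compG compT compT' hW hg γ₀ hreg
  obtain ⟨f, hf, hsupp, hpos⟩ := S.exists_test_orbital_re_pos
    (isCharacter_chi W R μ DG fdG compG compT compT' hc hu)
    (isCharacter'_chi' W R μ DG fdG compG compT compT' hc' hu') R.chi_centre γ₀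
    (isRegularRational_of_isLinRegular W γ₀ hreg) hU hγU
  refine ⟨f, ⟨hf.cont, hf.compact⟩, ?_⟩
  -- the geometric support of `f` is exactly the orbit of `γ₀`
  have hne : S.orbital R.chi R.chi' (S.orbitOf γ₀) f ≠ 0 := by
    intro h0
    rw [h0] at hpos
    simp at hpos
  have hgeo : S.geoSupport f = {S.orbitOf γ₀} := by
    apply Set.eq_singleton_iff_unique_mem.2
    refine ⟨?_, ?_⟩
    · by_contra hnot
      exact hne (S.orbital_eq_zero_of_not_mem R.chi R.chi' hnot)
    · rintro o ⟨t, ht, t', ht', γ, rfl, hfγ⟩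
      exact hiso t (subset_closure ht) t' (subset_closure ht') γ (hsupp (subset_tsupport _ hfγ))
  rw [Jc_eq_orbital_of_isolated W R μ DG fdG compG compT compT' hc hu hc' hu' ⟨hf.cont, hf.compact⟩ hgeo]
  exact hne

/-- **THE WEAK FORM OF W5, BY NAME**: on a genuine-row plane definite at some real place, with torus data of compact
closures and continuous unitary characters, the two-torus distribution `f ↦ R.Jc f` is non-zero on the test functions.
The cocompactness of `G(k)\G(𝔸)` is L1-p5's `quotient_compact_genuine`; the regular rational element is L1-p3's
`exists_regular_rational`.  NOT the wall (see the module docstring: no K-type constraint on `f`). -/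
theorem exists_test_Jc_ne_zero (compT : IsCompact (closure R.DT)) (compT' : IsCompact (closure R.DT'))
    (hW : IsDefinite W) (hg : IsGenuineRow W)
    (hc : Continuous R.chi) (hu : ∀ a, ‖R.chi a‖ = 1) (hc' : Continuous R.chi') (hu' : ∀ a, ‖R.chi' a‖ = 1) :
    ∃ f : GA W → ℂ, IsTestFn W f ∧ R.Jc f ≠ 0 := by
  haveI : T2Space (GA W) := t2Space_GA W
  haveI : LocallyCompactSpace (GA W) := locallyCompact_GA W
  obtain ⟨DG, fdG, compG⟩ := quotient_compact_genuine W hW hg (Measure.haar (G := GA W))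
  obtain ⟨γ₀, hreg⟩ := exists_regular_rational W hW hg
  exact exists_test_Jc_ne_zero_of_data W R (Measure.haar (G := GA W)) DG fdG compG compT compT' hW hg hc hu hc' hu'
    γ₀ hreg

end Main

end Summit.Ventures.HodgeRepro.Tier4.Line4

end
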